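import Summits.CriticalPhenomena.Ising3DConformalLimit.Theses.SynchronousCoupling
import Summits.CriticalPhenomena.Ising3DConformalLimit.Theorems.MirrorHoelderCompactnessLimitConstruction
import HarnessLib

/-!
# Route `SynchronousCoupling` — item `PinnedLimitConstruction` (stmt-CriticalPhenomena-19086)

`PinnedLimitConstruction : (PL) → UniformRegularity → ∃ ρ Δ S, (∀ δ ∈ (0,1], 0 < ρ δ) ∧ 0 < Δ ∧
HasPointwiseScalingLimit (criticalCorr 3) ρ S ∧ (S = 0 off NonCoincident) ∧ IsNondegenerateTwoPoint S ∧
IsTranslationInvariant S ∧ IsScaleCovariant Δ S`, where (PL) is the pinned pointwise limit (item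
stmt-CriticalPhenomena-6153 verbatim: for every `n` and non-coincident `x` the rescaled critical
correlator renormalised by `ρ★(δ) = ⟨σ₀σ_{⌊δ⁻¹⌋e₀}⟩^{-1/2}` converges as `δ → 0⁺`) and
`UniformRegularity` is item stmt-CriticalPhenomena-4658 verbatim (precompactness of the pinned zoom).

This is GLUE, proved unconditionally: the statement is, with its two hypotheses swapped, literally the
landed theorem `MirrorHoelderLimitConstruction.limitConstruction_proof`
(`Theorems/MirrorHoelderCompactnessLimitConstruction.lean`, item stmt-CriticalPhenomena-6159 of route
`MirrorHoelderCompactness`), whose antecedents `MirrorHoelderCompactness.UniformRegularity` /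
`MirrorHoelderCompactness.PointwiseLimit` are spelled byte-identically to this route's
`UniformRegularity` and (PL), so the two route-local `def`s agree by `δ`-unfolding.

Design (route-repair 2026-08-17): the route file `Theses/SynchronousCoupling.lean` deliberately does NOT
import `Theorems.MirrorHoelderCompactnessLimitConstruction` (its import cone carries unrelated unproved
named Literature facts); the deciding theorem `closes` takes `PinnedLimitConstruction` as a hypothesis
and THIS file, which imports both, discharges it. Nothing else is here.

References: Chelkak–Hongler–Izyurov, Ann. Math. 181 (2015), Thm 1.1 (statement shape, transposed to
`ℝ³`); the analysis (Arzelà–Ascoli without extraction + the pinned-limit structure theorem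
`ExistsScaleCovariantLimitNegative.crux_of_pinnedLimit`) is in the imported file. [folklore]
-/

namespace Summit.CriticalPhenomena.Ising3DConformalLimit.SynchronousCouplingPinnedLimitConstruction

/-- **Item stmt-CriticalPhenomena-19086 `PinnedLimitConstruction` (route `SynchronousCoupling`),
unconditionally.** The pinned pointwise limit (PL) together with `UniformRegularity` yields the
existence data `∃ ρ Δ S, ρ > 0 on (0,1] ∧ 0 < Δ ∧ HasPointwiseScalingLimit (criticalCorr 3) ρ S ∧
S = 0 off NonCoincident ∧ IsNondegenerateTwoPoint S ∧ IsTranslationInvariant S ∧ IsScaleCovariant Δ S`.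
Proof: swap the hypotheses and apply the landed
`MirrorHoelderLimitConstruction.limitConstruction_proof` (the route-local definitions
`SynchronousCoupling.UniformRegularity` and `MirrorHoelderCompactness.UniformRegularity`, and (PL) and
`MirrorHoelderCompactness.PointwiseLimit`, unfold to the same terms). [folklore] -/
theorem pinnedLimitConstruction_proof :
    Summit.CriticalPhenomena.Ising3DConformalLimit.Theses.SynchronousCoupling.PinnedLimitConstruction := by
  unfold Summit.CriticalPhenomena.Ising3DConformalLimit.Theses.SynchronousCoupling.PinnedLimitConstruction
  intro hPL hUR
  exact Summit.CriticalPhenomena.Ising3DConformalLimit.MirrorHoelderLimitConstruction.limitConstruction_proof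
    hUR hPL

end Summit.CriticalPhenomena.Ising3DConformalLimit.SynchronousCouplingPinnedLimitConstruction
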